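import Summits.Ventures.Crystal3D.Theorems.StickyWulffConstantGenericWallFloorStackWalkReverse
import Summits.Ventures.Crystal3D.Theorems.StickyWulffConstantCoaxialWallLawWordRigidity
import HarnessLib

/-!
# Stack rigidity: the slot dozen of a walker's top frame determines its whole stack (crux `GenericWallFloor`,
# line `WallLedgerG`; second brick of the MERGE LOCALISATION of the stack ledger's residual `LOST`)

HONEST FRAMING. Part of the venture `Summits/Ventures/Crystal3D` (cell `crystal3d-full`), helper
`--supports` the crux `GenericWallFloor` (stmt-Ventures-19480) of `route-Ventures-StickyWulffConstant`,
registered line `WallLedgerG`, open stub `stub_twoSlabAdhesion` (general fillings).  Sequel of `…StackWalkReverse`.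
The frames of a sound well-formed stack (`StackSound`, `StackWF`) are obtained from the bottom frame by a
REDUCED chain of `{111}` mirrors; by the 3-adic NonReturn theorem (`foldl_reflect_slots_false`, seat 19481-p2)
a reduced mirror word is determined by the slot dozen of its frame.  Hence:

* `wordFrame`, `stackWord`, `stackBase` — the model mirror word of a stack (entry normals pulled back to the
  frame below, most recent first) and its frame; `frame_eq_wordFrame`, `stackWord_letters` (unit model menu
  letters meeting at `±1/3`: consecutive entry normals are distinct by `StackWF` and not antipodal by the
  orientation `⟪G v, n⟫ = +√(2/3)` of `Link`/`Sound`).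
* `map_reflection_eq_of_image_eq` — two reduced menu words whose frames have the same slot dozen have the same
  MIRROR sequence (letters agree up to sign; common-suffix gluing as in `word_eq_of_image_eq`).
* **`stack_eq_of_image_eq`** — two sound well-formed stacks with the same bottom entry whose top frames have
  the same slot dozen are EQUAL (signs of the letters are pinned by the orientation, directions by `StackWF`).
* **`stack_adjacent_of_twin_image`** — if instead the top slot dozen of the second is the mirror image of the
  first's across a menu normal `m` of the first top frame, one stack is the other with ONE more level
  (`Σ3`-adjacent stacks).
With `…StackWalkReverse` this feeds the local description of coincident walk ends (next brick): distinct end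
states at one ball have non-co-axial top lattices or are `Σ3`-adjacent.

WHAT THIS IS NOT: not the stub; `ExactOnly` (C12-55) stays an input of the ledger; F-C1 not moved.
-/

noncomputable section

namespace Summit.Ventures.Crystal3D.Theorems

open Finset
open scoped InnerProductSpace

/-! ### Reflections of unit vectors -/

/-- `R_{−a} = R_a`. -/
theorem reflection_neg_eq {a : EuclideanSpace ℝ (Fin 3)} (ha : ‖a‖ = 1) :
    (ℝ ∙ (-a))ᗮ.reflection = (ℝ ∙ a)ᗮ.reflection :=
  LinearIsometryEquiv.ext fun x => by
    rw [reflection_unit_apply ha, reflection_unit_apply (by rw [norm_neg, ha]), inner_neg_right, mul_neg,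
      neg_smul, smul_neg, neg_neg]

/-- Unit vectors with the same mirror agree up to sign. -/
theorem eq_or_eq_neg_of_reflection_eq {a b : EuclideanSpace ℝ (Fin 3)} (ha : ‖a‖ = 1) (hb : ‖b‖ = 1)
    (h : (ℝ ∙ a)ᗮ.reflection = (ℝ ∙ b)ᗮ.reflection) : a = b ∨ a = -b := by
  have h1 := congrArg (fun Φ : EuclideanSpace ℝ (Fin 3) ≃ₗᵢ[ℝ] EuclideanSpace ℝ (Fin 3) => Φ a) h
  rw [reflection_unit_apply ha, reflection_unit_apply hb, real_inner_self_eq_norm_sq, ha] at h1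
  have hx : ((2 : ℝ) * (1 : ℝ) ^ 2) • a = (2 * ⟪a, b⟫_ℝ) • b := sub_right_inj.1 h1
  have hi := congrArg (fun v => ⟪v, a⟫_ℝ) hx
  simp only [real_inner_smul_left] at hi
  rw [real_inner_self_eq_norm_sq, ha, real_inner_comm a b] at hi
  have hsq : ⟪a, b⟫_ℝ * ⟪a, b⟫_ℝ = 1 := by nlinarith [hi]
  rcases mul_self_eq_one_iff.1 hsq with h' | h'
  · exact Or.inl ((inner_eq_one_iff_of_norm_eq_one ha hb).1 h')
  · exact Or.inr (eq_neg_of_inner_eq_neg_one' hb ha (by rw [real_inner_comm]; exact h'))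

/-! ### Model words and their frames -/

/-- The FRAME of a model mirror word `κ = [μ₁, …, μ_k]` (most recent letter first) over the base frame `B`:
`B ∘ R_{μ_k} ∘ ⋯ ∘ R_{μ₁}` (the convention of `…WordLetters`: `F (μ :: κ) = R_μ.trans (F κ)`). -/
def wordFrame (B : EuclideanSpace ℝ (Fin 3) ≃ₗᵢ[ℝ] EuclideanSpace ℝ (Fin 3)) :
    List (EuclideanSpace ℝ (Fin 3)) → (EuclideanSpace ℝ (Fin 3) ≃ₗᵢ[ℝ] EuclideanSpace ℝ (Fin 3))
  | [] => B
  | μ :: κ => ((ℝ ∙ μ)ᗮ.reflection).trans (wordFrame B κ)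

/-- The recursion of `wordFrame`. -/
theorem wordFrame_cons (B : EuclideanSpace ℝ (Fin 3) ≃ₗᵢ[ℝ] EuclideanSpace ℝ (Fin 3))
    (μ : EuclideanSpace ℝ (Fin 3)) (κ : List (EuclideanSpace ℝ (Fin 3))) :
    wordFrame B (μ :: κ) = ((ℝ ∙ μ)ᗮ.reflection).trans (wordFrame B κ) := rfl

/-- `wordFrame` only sees the mirrors. -/
theorem wordFrame_eq_of_map_eq (B : EuclideanSpace ℝ (Fin 3) ≃ₗᵢ[ℝ] EuclideanSpace ℝ (Fin 3)) :
    ∀ {κ κ' : List (EuclideanSpace ℝ (Fin 3))},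
      κ.map (fun μ => (ℝ ∙ μ)ᗮ.reflection) = κ'.map (fun μ => (ℝ ∙ μ)ᗮ.reflection) →
      wordFrame B κ = wordFrame B κ'
  | [], [], _ => rfl
  | [], _ :: _, h => by simp at h
  | _ :: _, [], h => by simp at h
  | μ :: κ, μ' :: κ', h => by
    simp only [List.map_cons, List.cons.injEq] at h
    rw [wordFrame_cons, wordFrame_cons, h.1, wordFrame_eq_of_map_eq B h.2]

/-- The twin frame as a one-letter word: `twinFrame G n = R_{G⁻¹n}.trans G`. -/
theorem twinFrame_eq_reflection_trans (G : EuclideanSpace ℝ (Fin 3) ≃ₗᵢ[ℝ] EuclideanSpace ℝ (Fin 3))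
    {n : EuclideanSpace ℝ (Fin 3)} (hn : ‖n‖ = 1) :
    twinFrame G n = ((ℝ ∙ (G.symm n))ᗮ.reflection).trans G :=
  LinearIsometryEquiv.ext fun x => by
    have hμ : ‖G.symm n‖ = 1 := by rw [LinearIsometryEquiv.norm_map, hn]
    rw [twinFrame_apply G hn, LinearIsometryEquiv.trans_apply, reflection_unit_apply hμ, ← mirror_conj,
      LinearIsometryEquiv.apply_symm_apply]

/-- **Reduced menu words are rigid up to letter signs.**  Two words of unit model menu normals with
consecutive letters at `±1/3` whose frames (over the same base) have the same slot dozen have the same mirror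
sequence. -/
theorem map_reflection_eq_of_image_eq (B : EuclideanSpace ℝ (Fin 3) ≃ₗᵢ[ℝ] EuclideanSpace ℝ (Fin 3))
    {κ κ' : List (EuclideanSpace ℝ (Fin 3))}
    (hl : ∀ μ ∈ κ, ‖μ‖ = 1 ∧
      ∀ w ∈ fccSlots, ⟪w, μ⟫_ℝ = 0 ∨ ⟪w, μ⟫_ℝ = Real.sqrt (2 / 3) ∨ ⟪w, μ⟫_ℝ = -Real.sqrt (2 / 3))
    (hc : List.IsChain (fun μ μ' => ⟪μ, μ'⟫_ℝ = 1 / 3 ∨ ⟪μ, μ'⟫_ℝ = -1 / 3) κ)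
    (hl' : ∀ μ ∈ κ', ‖μ‖ = 1 ∧
      ∀ w ∈ fccSlots, ⟪w, μ⟫_ℝ = 0 ∨ ⟪w, μ⟫_ℝ = Real.sqrt (2 / 3) ∨ ⟪w, μ⟫_ℝ = -Real.sqrt (2 / 3))
    (hc' : List.IsChain (fun μ μ' => ⟪μ, μ'⟫_ℝ = 1 / 3 ∨ ⟪μ, μ'⟫_ℝ = -1 / 3) κ')
    (himg : (wordFrame B κ : EuclideanSpace ℝ (Fin 3) → EuclideanSpace ℝ (Fin 3)) '' ↑fccSlots =
      (wordFrame B κ' : EuclideanSpace ℝ (Fin 3) → EuclideanSpace ℝ (Fin 3)) '' ↑fccSlots) :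
    κ.map (fun μ => (ℝ ∙ μ)ᗮ.reflection) = κ'.map (fun μ => (ℝ ∙ μ)ᗮ.reflection) := by
  obtain ⟨β, β', τ, hρ, hρ', hne⟩ :=
    exists_common_suffix (κ.map (fun μ => (ℝ ∙ μ)ᗮ.reflection)) (κ'.map (fun μ => (ℝ ∙ μ)ᗮ.reflection))
  obtain ⟨α, γ, rfl, hα, hγ⟩ := List.map_eq_append_iff.1 hρ
  obtain ⟨α', γ', rfl, hα', hγ'⟩ := List.map_eq_append_iff.1 hρ'
  have hγγ : wordFrame B γ = wordFrame B γ' := wordFrame_eq_of_map_eq B (hγ.trans hγ'.symm)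
  have hαu : ∀ μ ∈ α, ‖μ‖ = 1 := fun μ hμ => (hl μ (List.mem_append_left γ hμ)).1
  have hα'u : ∀ μ ∈ α', ‖μ‖ = 1 := fun μ hμ => (hl' μ (List.mem_append_left γ' hμ)).1
  -- it suffices that the glued list `α ++ α'.reverse` is empty
  suffices h : α ++ α'.reverse = [] by
    obtain ⟨h1, h2⟩ := List.append_eq_nil_iff.1 h
    have h2' := List.reverse_eq_nil_iff.1 h2
    subst h1; subst h2'
    rw [List.nil_append, List.nil_append, hγ, hγ']
  by_contra hL
  refine foldl_reflect_slots_false (α ++ α'.reverse) hL ?_ ?_ ?_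
  · -- letters: unit model menu normals
    intro μ hμ
    rcases List.mem_append.1 hμ with h | h
    · exact hl μ (List.mem_append_left γ h)
    · exact hl' μ (List.mem_append_left γ' (List.mem_reverse.1 h))
  · -- the chain condition
    rw [List.isChain_append]
    refine ⟨hc.left_of_append, ?_, ?_⟩
    · rw [List.isChain_reverse]
      exact hc'.left_of_append.imp fun a b h => by rw [real_inner_comm]; exact h
    · intro x hx y hy
      rw [List.head?_reverse] at hy
      have hRxy : (ℝ ∙ x)ᗮ.reflection ≠ (ℝ ∙ y)ᗮ.reflection := by
        refine hne _ ?_ _ ?_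
        · rw [← hα, List.getLast?_map, hx]; rfl
        · rw [← hα', List.getLast?_map, hy]; rfl
      obtain ⟨hx1, hxm⟩ := hl x (List.mem_append_left γ (List.mem_of_getLast? hx))
      obtain ⟨hy1, hym⟩ := hl' y (List.mem_append_left γ' (List.mem_of_getLast? hy))
      have hmx : ∀ w ∈ fccSlots,
          ⟪(LinearIsometryEquiv.refl ℝ (EuclideanSpace ℝ (Fin 3))) w, x⟫_ℝ = 0 ∨
          ⟪(LinearIsometryEquiv.refl ℝ (EuclideanSpace ℝ (Fin 3))) w, x⟫_ℝ = Real.sqrt (2 / 3) ∨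
          ⟪(LinearIsometryEquiv.refl ℝ (EuclideanSpace ℝ (Fin 3))) w, x⟫_ℝ = -Real.sqrt (2 / 3) := by
        intro w hw; simpa using hxm w hw
      have hmy : ∀ w ∈ fccSlots,
          ⟪(LinearIsometryEquiv.refl ℝ (EuclideanSpace ℝ (Fin 3))) w, y⟫_ℝ = 0 ∨
          ⟪(LinearIsometryEquiv.refl ℝ (EuclideanSpace ℝ (Fin 3))) w, y⟫_ℝ = Real.sqrt (2 / 3) ∨
          ⟪(LinearIsometryEquiv.refl ℝ (EuclideanSpace ℝ (Fin 3))) w, y⟫_ℝ = -Real.sqrt (2 / 3) := by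
        intro w hw; simpa using hym w hw
      rcases inner_menuNormals (LinearIsometryEquiv.refl ℝ _) hx1 hy1 hmx hmy with h | h | h | h
      · have hxy : x = y := (inner_eq_one_iff_of_norm_eq_one (𝕜 := ℝ) hx1 hy1).1 h
        subst hxy; exact absurd rfl hRxy
      · have hyx : y = -x := eq_neg_of_inner_eq_neg_one' hx1 hy1 h
        subst hyx; exact absurd (reflection_neg_eq hx1).symm hRxy
      · exact Or.inl h
      · exact Or.inr h
  · -- the glued mirror chain maps the slots into the slots
    intro w hw
    have hmem : (wordFrame B (α ++ γ) : EuclideanSpace ℝ (Fin 3) → EuclideanSpace ℝ (Fin 3)) w ∈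
        (wordFrame B (α' ++ γ') : EuclideanSpace ℝ (Fin 3) → EuclideanSpace ℝ (Fin 3)) '' ↑fccSlots := by
      rw [← himg]; exact Set.mem_image_of_mem _ (Finset.mem_coe.2 hw)
    obtain ⟨w', hw', heq⟩ := hmem
    rw [Finset.mem_coe] at hw'
    rw [word_F_append_apply (F := wordFrame B) (fun _ _ => rfl) α hαu,
      word_F_append_apply (F := wordFrame B) (fun _ _ => rfl) α' hα'u, ← hγγ] at heq
    have heq' := (wordFrame B γ).injective heq
    have key := foldl_reflect_reverse_foldl α' hα'u w'
    rw [heq', ← List.foldl_append] at key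
    rw [key]; exact hw'

/-! ### The mirror word of a stack -/

/-- The MODEL MIRROR WORD of a stack (most recent letter first): each non-bottom entry contributes its entry
normal pulled back to the frame of the level below. -/
def stackWord : List WalkEntry → List (EuclideanSpace ℝ (Fin 3))
  | [] => []
  | [_] => []
  | e :: e' :: rest => e'.frame.symm e.nrm :: stackWord (e' :: rest)

/-- The BASE FRAME of a stack: the frame of its bottom entry (`refl` for the empty stack). -/
def stackBase : List WalkEntry → (EuclideanSpace ℝ (Fin 3) ≃ₗᵢ[ℝ] EuclideanSpace ℝ (Fin 3))
  | [] => LinearIsometryEquiv.refl ℝ _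
  | [e] => e.frame
  | _ :: e' :: rest => stackBase (e' :: rest)

/-- Unfolding of `stackWord`. -/
@[simp] theorem stackWord_cons_cons (e e' : WalkEntry) (rest : List WalkEntry) :
    stackWord (e :: e' :: rest) = e'.frame.symm e.nrm :: stackWord (e' :: rest) := rfl

/-- Unfolding of `stackWord`, one level. -/
@[simp] theorem stackWord_singleton (e : WalkEntry) : stackWord [e] = [] := rfl

/-- The base frame is read off the last entry. -/
theorem stackBase_eq_getLast? : ∀ stk : List WalkEntry,
    stackBase stk = (stk.getLast?.map WalkEntry.frame).getD (LinearIsometryEquiv.refl ℝ _)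
  | [] => rfl
  | [_] => rfl
  | _ :: e' :: rest => by
    rw [stackBase, List.getLast?_cons_cons, stackBase_eq_getLast? (e' :: rest)]

/-- **The top frame is the frame of the stack's word** over its base. -/
theorem frame_eq_wordFrame {z : EuclideanSpace ℝ (Fin 3)} :
    ∀ (e : WalkEntry) (rest : List WalkEntry), StackSound z (e :: rest) →
      e.frame = wordFrame (stackBase (e :: rest)) (stackWord (e :: rest))
  | _, [], _ => rfl
  | e, e' :: rest, hS => by
    obtain ⟨hSo, hLi, hS'⟩ := hS
    rw [stackWord_cons_cons, wordFrame_cons, stackBase, ← frame_eq_wordFrame e' rest hS',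
      ← twinFrame_eq_reflection_trans e'.frame hSo.2.1]
    exact frame_eq_twinFrame_of_link hSo.2.1 hLi

/-- **Letters of a stack word.**  For a sound well-formed stack: unit model menu normals, consecutive ones at
`±1/3` (distinct by `StackWF`, not antipodal by the `Link` orientation). -/
theorem stackWord_letters {z : EuclideanSpace ℝ (Fin 3)} :
    ∀ (stk : List WalkEntry), StackSound z stk → StackWF z stk →
      (∀ μ ∈ stackWord stk, ‖μ‖ = 1 ∧
        ∀ w ∈ fccSlots, ⟪w, μ⟫_ℝ = 0 ∨ ⟪w, μ⟫_ℝ = Real.sqrt (2 / 3) ∨ ⟪w, μ⟫_ℝ = -Real.sqrt (2 / 3)) ∧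
      List.IsChain (fun μ μ' => ⟪μ, μ'⟫_ℝ = 1 / 3 ∨ ⟪μ, μ'⟫_ℝ = -1 / 3) (stackWord stk)
  | [], hS, _ => (stackSound_nil z hS).elim
  | [e], _, _ => ⟨fun μ hμ => by simp at hμ, by simp⟩
  | e :: e' :: rest, hS, hW => by
    have hrpos : 0 < Real.sqrt (2 / 3) := Real.sqrt_pos.2 (by norm_num)
    obtain ⟨hSo, hLi, hS'⟩ := hS
    obtain ⟨-, hne, hW'⟩ := hW
    obtain ⟨hlet', hchain'⟩ := stackWord_letters (e' :: rest) hS' hW'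
    obtain ⟨-, hn, hmenu, -, -, -, -⟩ := hSo
    have hG : ∀ x, e'.frame x = e.frame x - (2 * ⟪e.frame x, e.nrm⟫_ℝ) • e.nrm := twin_symm e'.frame e.frame hn hLi.1
    have hmenuG := menu_reflect e.frame e'.frame hn hmenu hG
    -- the new letter
    have hμ : ‖e'.frame.symm e.nrm‖ = 1 ∧ ∀ w ∈ fccSlots, ⟪w, e'.frame.symm e.nrm⟫_ℝ = 0 ∨
        ⟪w, e'.frame.symm e.nrm⟫_ℝ = Real.sqrt (2 / 3) ∨ ⟪w, e'.frame.symm e.nrm⟫_ℝ = -Real.sqrt (2 / 3) := by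
      refine ⟨by rw [LinearIsometryEquiv.norm_map, hn], fun w hw => ?_⟩
      rw [← LinearIsometryEquiv.inner_map_map e'.frame, LinearIsometryEquiv.apply_symm_apply]
      exact hmenuG w hw
    refine ⟨fun μ hμm => ?_, ?_⟩
    · rw [stackWord_cons_cons, List.mem_cons] at hμm
      rcases hμm with rfl | h
      · exact hμ
      · exact hlet' μ h
    · rw [stackWord_cons_cons, List.isChain_cons]
      refine ⟨fun μ' hμ' => ?_, hchain'⟩
      cases rest with
      | nil => simp at hμ'
      | cons e'' rest' =>
        rw [stackWord_cons_cons, List.head?_cons, Option.mem_some_iff] at hμ'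
        subst hμ'
        obtain ⟨hSo', hLi', -⟩ := hS'
        obtain ⟨-, hn', hmenu', hvn', -, -, -⟩ := hSo'
        -- `e′.frame⁻¹ = e″.frame⁻¹ ∘ R_{n′}`
        have hfr : e'.frame = twinFrame e''.frame e'.nrm := frame_eq_twinFrame_of_link hn' hLi'
        have hsymm : ∀ x, e'.frame.symm x = e''.frame.symm ((ℝ ∙ e'.nrm)ᗮ.reflection x) := fun x => by
          rw [hfr]; rfl
        rw [hsymm, LinearIsometryEquiv.inner_map_map, inner_reflection_unit hn']
        rcases inner_menuNormals e'.frame hn hn' hmenuG hmenu' with h | h | h | h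
        · exact absurd ((inner_eq_one_iff_of_norm_eq_one (𝕜 := ℝ) hn hn').1 h) hne
        · have h' : e'.nrm = -e.nrm := eq_neg_of_inner_eq_neg_one' hn hn' h
          have h1 := hLi.2
          rw [h', inner_neg_right, h1] at hvn'
          linarith
        · right; rw [h]; ring
        · left; rw [h]; ring

/-- **Equal mirror sequences and bottoms give equal stacks** (orientation pins the letter signs, `StackWF` the
directions). -/
theorem stack_eq_of_map_stackWord_eq {z : EuclideanSpace ℝ (Fin 3)} :
    ∀ (stk₁ stk₂ : List WalkEntry), StackSound z stk₁ → StackWF z stk₁ → StackSound z stk₂ → StackWF z stk₂ →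
      stk₁.getLast? = stk₂.getLast? →
      (stackWord stk₁).map (fun μ => (ℝ ∙ μ)ᗮ.reflection) = (stackWord stk₂).map (fun μ => (ℝ ∙ μ)ᗮ.reflection) →
      stk₁ = stk₂
  | [], _, hS₁, _, _, _, _, _ => (stackSound_nil z hS₁).elim
  | _ :: _, [], _, _, hS₂, _, _, _ => (stackSound_nil z hS₂).elim
  | [e₁], [e₂], _, _, _, _, hlast, _ => by simpa using hlast
  | [_], _ :: _ :: _, _, _, _, _, _, hmap => by simp at hmap
  | _ :: _ :: _, [_], _, _, _, _, _, hmap => by simp at hmap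
  | e₁ :: e₁' :: r₁, e₂ :: e₂' :: r₂, hS₁, hW₁, hS₂, hW₂, hlast, hmap => by
    have hrpos : 0 < Real.sqrt (2 / 3) := Real.sqrt_pos.2 (by norm_num)
    rw [stackWord_cons_cons, stackWord_cons_cons, List.map_cons, List.map_cons, List.cons.injEq] at hmap
    rw [List.getLast?_cons_cons, List.getLast?_cons_cons] at hlast
    obtain ⟨hSo₁, hLi₁, hS₁'⟩ := hS₁
    obtain ⟨hSo₂, hLi₂, hS₂'⟩ := hS₂
    have htail := stack_eq_of_map_stackWord_eq (e₁' :: r₁) (e₂' :: r₂) hS₁' hW₁.2.2 hS₂' hW₂.2.2 hlast hmap.2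
    injection htail with he' hr
    subst he'; subst hr
    -- the top letters: equal mirrors, hence equal up to sign, hence equal by the orientation
    have hn₁ := hSo₁.2.1
    have hn₂ := hSo₂.2.1
    have hμ₁ : ‖e₁'.frame.symm e₁.nrm‖ = 1 := by rw [LinearIsometryEquiv.norm_map, hn₁]
    have hμ₂ : ‖e₁'.frame.symm e₂.nrm‖ = 1 := by rw [LinearIsometryEquiv.norm_map, hn₂]
    have hnn : e₁.nrm = e₂.nrm := by
      rcases eq_or_eq_neg_of_reflection_eq hμ₁ hμ₂ hmap.1 with h | h
      · simpa using congrArg e₁'.frame h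
      · have h' : e₁.nrm = -e₂.nrm := by simpa using congrArg e₁'.frame h
        have h1 := hLi₁.2
        rw [h', inner_neg_right, hLi₂.2] at h1
        linarith
    have hee : e₁ = e₂ := by
      refine WalkEntry.eq_of_parts ?_ ?_ hnn
      · rw [frame_eq_twinFrame_of_link hn₁ hLi₁, frame_eq_twinFrame_of_link hn₂ hLi₂, hnn]
      · rw [hW₁.1, hW₂.1, frame_eq_twinFrame_of_link hn₁ hLi₁, frame_eq_twinFrame_of_link hn₂ hLi₂, hnn]
    rw [hee]

/-- **Stack rigidity.**  Two sound well-formed stacks with the same bottom entry whose top frames have the same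
slot dozen are equal. -/
theorem stack_eq_of_image_eq {z : EuclideanSpace ℝ (Fin 3)} {e₁ e₂ : WalkEntry} {r₁ r₂ : List WalkEntry}
    (hS₁ : StackSound z (e₁ :: r₁)) (hW₁ : StackWF z (e₁ :: r₁)) (hS₂ : StackSound z (e₂ :: r₂))
    (hW₂ : StackWF z (e₂ :: r₂)) (hlast : (e₁ :: r₁).getLast? = (e₂ :: r₂).getLast?)
    (himg : (e₁.frame : EuclideanSpace ℝ (Fin 3) → EuclideanSpace ℝ (Fin 3)) '' ↑fccSlots =
      (e₂.frame : EuclideanSpace ℝ (Fin 3) → EuclideanSpace ℝ (Fin 3)) '' ↑fccSlots) :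
    e₁ :: r₁ = e₂ :: r₂ := by
  have hbase : stackBase (e₁ :: r₁) = stackBase (e₂ :: r₂) := by
    rw [stackBase_eq_getLast?, stackBase_eq_getLast?, hlast]
  obtain ⟨hl₁, hc₁⟩ := stackWord_letters _ hS₁ hW₁
  obtain ⟨hl₂, hc₂⟩ := stackWord_letters _ hS₂ hW₂
  rw [frame_eq_wordFrame e₁ r₁ hS₁, frame_eq_wordFrame e₂ r₂ hS₂, hbase] at himg
  exact stack_eq_of_map_stackWord_eq _ _ hS₁ hW₁ hS₂ hW₂ hlast
    (map_reflection_eq_of_image_eq _ hl₁ hc₁ hl₂ hc₂ himg)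

end Summit.Ventures.Crystal3D.Theorems

end
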